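import Summits.HodgeConjecture.HodgeConjecture.Theses.AmpleAdicLefschetz

/-!
# Route AmpleAdicLefschetz — `TargetOfCruxes` (item stmt-HodgeConjecture-14258)

Glue to the route's frame statement: `Target` is, on the nose, the conjunction of the bodies of the
two cruxes `ThickDescent` (THICK) and `SectionalSource` (SS), so
`ThickDescent → SectionalSource → Target` is the pairing of the two hypotheses.  No mathematical
content beyond bookkeeping; `Target ↔ ThickDescent ∧ SectionalSource` holds by `Iff.rfl`.
-/

-- `Summit.HodgeConjecture.HodgeConjecture.Theorems` is the mandated namespace (single-problem summit:
-- Problem = Summit), which `linter.dupNamespace` flags on every declaration; the lakefile turns the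
-- linter off for the Summits library (weak option), restated here so stand-alone elaboration is warning-free.
set_option linter.dupNamespace false

namespace Summit.HodgeConjecture.HodgeConjecture.Theorems

/-- The route target `Target` of AmpleAdicLefschetz is definitionally the conjunction
`ThickDescent ∧ SectionalSource` (both bodies are inlined verbatim in the route file because `Target`
is rendered before the crux decls). -/
theorem ampleAdicLefschetz_target_iff :
    Summit.HodgeConjecture.HodgeConjecture.Theses.AmpleAdicLefschetz.Target ↔
      Summit.HodgeConjecture.HodgeConjecture.Theses.AmpleAdicLefschetz.ThickDescent ∧
        Summit.HodgeConjecture.HodgeConjecture.Theses.AmpleAdicLefschetz.SectionalSource :=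
  Iff.rfl

/-- **Item stmt-HodgeConjecture-14258 (`TargetOfCruxes`)**: the two cruxes `ThickDescent` and
`SectionalSource` give the route target `Target = ThickDescent ∧ SectionalSource` (both bodies
inlined verbatim in the route file, so the conjunction is definitional).  The type is literally the
route decl `Summit.HodgeConjecture.HodgeConjecture.Theses.AmpleAdicLefschetz.TargetOfCruxes`. -/
theorem ampleAdicLefschetz_targetOfCruxes_proof :
    Summit.HodgeConjecture.HodgeConjecture.Theses.AmpleAdicLefschetz.TargetOfCruxes := by
  unfold Summit.HodgeConjecture.HodgeConjecture.Theses.AmpleAdicLefschetz.TargetOfCruxes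
  intro hT hS
  exact ampleAdicLefschetz_target_iff.mpr ⟨hT, hS⟩

end Summit.HodgeConjecture.HodgeConjecture.Theorems
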